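import Summits.QuantumFields.BalabanUV.Beta.HarmonicGradientInterior
import Summits.QuantumFields.BalabanUV.Beta.TorusInversePowerSums
import Summits.QuantumFields.BalabanUV.Beta.GraphGreenFunction

/-!
# Beta / GreenGradientRowSum — THE DIPOLE ROW SUM OF THE DIRICHLET GREEN'S FUNCTION OF THE FLAT TORUS LAPLACIAN:
# `Σ_{y ∈ B} |green_B(x + e_μ, y) − green_B(x, y)| ≤ C·K·(D+1)·(1 + (D+1)/(ρ+1))` for a `ρ`-interior site `x` of `B ⊆ ball(x, D)`, from the
# interior difference estimate (GR1) and ONE pointwise Green bound `green_B(x′,y) ≤ K·(dist(x′,y)+1)^{−(d−2)}` (hypothesis; d = 4 by road P3)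
# (second module of the chain «LATTICE-GRADIENT-MEMBER»: the GRADIENT member (3.42)₂'s SHAPE at MODEL level, O.2 item (i))

WHAT IS CERTIFIED (kernel, 0 sorry).  Unit torus `UT N`, bonds `bsrc∕btgt`, CONSTANT weight `c ≡ c₀ ≠ 0`, a finite `B` carrying a nonnegative
unit supersolution `w₀` (road P3's `GraphGreenFunction.dirSol ∕ green` setting; on torus boxes an4's `exists_unit_supersolution_box`), and the
POINTWISE GREEN HYPOTHESIS `hG : green B x′ y ≤ K·((dist x′ y + 1)^{d−2})⁻¹` (`K ≥ 0`):
* §1 `green_harmonic_off_pole` (`green(·,y)` is harmonic on `B ∖ {y}`: `dirSol_eq_on`), `abs_sub_le_of_nonneg_le`;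
* §2 **`abs_fdiff_green_le_far`** — for `ρ ≥ 1`, `10ρ+4 ≤ N_i`, `ball(x, 2ρ+2) ⊆ B` and `dist(x,y) = s ≥ 8`:
  `|green(x+e_μ,y) − green(x,y)| ≤ K_d·K·2^{d−2}·((s+1)^{d−2})⁻¹·((ρ+1)⁻¹ + 8(s+1)⁻¹)` — GR1 `harmonic_fdiff_le` at radius `R = min(ρ, s/8)`
  (the pole stays at distance `≥ s/2` from the ball of radius `2R+2 ≤ s/2`); **`abs_fdiff_green_le`** — the unified pointwise bound
  `≤ C₁·K·(((s+1)^{d−1})⁻¹ + ((s+1)^{d−2})⁻¹(ρ+1)⁻¹)`, `C₁ = 8·2^{d−2}K_d + 8^{d−1}` (`Cdip`), for EVERY `y` (near poles by `0 ≤ green ≤ K`);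
* §3 **`sum_abs_fdiff_green_le`** — if moreover `dist(x,y) ≤ D` on `B`:
  **`Σ_{y ∈ B} |green(x+e_μ,y) − green(x,y)| ≤ C₁·C_ps·K·(D+1)·(1 + (D+1)/(ρ+1))`** (`TorusInversePowerSums.sum_inv_pow_dist_le`), i.e.
  `O(ρ)` for `D ≍ ρ` — the ℓ¹ norm of the DIPOLE potential, one power of the radius where the monopole row sum has two.
(unit `b2b-balaban-beta-d4-p2`, GEN 11, MODEL crew; claim «LATTICE-GRADIENT-MEMBER» journal l.23681; consumer: `GradientMemberBox`.)

HONEST FRAMING: discharging `BetaPertH` makes Bałaban's UV stability UNCONDITIONAL — NOT the continuum limit, NOT the Clay problem.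
HONEST DEPENDENCY (verbatim): «continuum YM on T⁴ ⇐ BetaPertH ∧ nine spine estimates (0/9 proved); BetaPertH ⇐ (D1) ∧ (D4) ∧ CAP+tail;
G-an2-4 gates asym, D1 and NE2/3/4.»  THIS MODULE DISCHARGES NOTHING of `BetaPertH`, asserts NOTHING printed and cites nothing as a fact
(ABSOLUTE RULE): [folklore] discrete potential theory of the FREE torus Laplacian (constant weight, flat transport); the pointwise Green bound
is a HYPOTHESIS here (for `d = 4` it is road P3's lattice Newton potential `LatticeNewtonPotentialD4` ∕ `HarmonicMeasureBoundD4`); print's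
(3.42)₂ for `G′(U)` is [B4] Lemma 2.2's (p,q)-chain — NOT reproduced.  LOCATORS (shape only): [Balaban1985BackgroundPropagators] Thm 3.1
(3.42) p. 397.  No class change on row D4 (critical-path width 0; D4 DISCHARGE NO DATE); NOT BetaPertH, NOT continuum, NOT Clay.
-/

open scoped BigOperators
open Finset

namespace Summit.QuantumFields.BalabanUV.Beta.GreenGradientRowSum

open Literature.MathematicalPhysics.QuantumFieldTheory.Balaban1983to89
open Literature.MathematicalPhysics.QuantumFieldTheory.Balaban1983to89.B9Thm37GluePU (bsrc btgt)
open B5TorusCover (UT)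
open B5Leibniz121 (up)
open Summit.QuantumFields.BalabanUV.Beta.HarmonicGradientInterior (Kgrad harmonic_fdiff_le dist_up_le_add_one)
open Summit.QuantumFields.BalabanUV.Beta.TorusInversePowerSums (Cps Cps_nonneg sum_inv_pow_dist_le)
open Summit.QuantumFields.BalabanUV.Beta.GraphGreenFunction (green dirSol_eq_on green_nonneg)
open Summit.QuantumFields.BalabanUV.Beta.SubsolutionMeanValueBox (Cmv_pos)
open Summit.QuantumFields.BalabanUV.Beta.DeGiorgiStep (dist_natCast)

noncomputable section

variable {d : ℕ} {N : Fin d → ℕ} [∀ i, NeZero (N i)]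

omit [∀ i, NeZero (N i)] in
/-- `K_d ≥ 0` (`d ≥ 1`). [folklore] -/
theorem Kgrad_nonneg {d : ℕ} (hd : 1 ≤ d) : 0 ≤ Kgrad d := by
  unfold Kgrad; have := Cmv_pos hd; positivity

omit [∀ i, NeZero (N i)] in
/-- `0 ≤ a ≤ K`, `0 ≤ b ≤ K` ⟹ `|a − b| ≤ K`. [folklore] -/
theorem abs_sub_le_of_nonneg_le {a b K : ℝ} (ha0 : 0 ≤ a) (haK : a ≤ K) (hb0 : 0 ≤ b) (hbK : b ≤ K) : |a - b| ≤ K := by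
  rw [abs_sub_le_iff]; constructor <;> linarith

section Green

variable {c : UT N × Fin d → ℝ} {c₀ : ℝ} (hc : ∀ b, c b = c₀) (hc₀ : c₀ ≠ 0)
  (B : Finset (UT N)) (w₀ : UT N → ℝ) (hw₀0 : ∀ y, 0 ≤ w₀ y)
  (hw₀ : ∀ x ∈ B, 1 + ((∑ b ∈ univ.filter (fun b : UT N × Fin d => btgt b = x), c b ^ 2 * w₀ (bsrc b)) +
      ∑ b ∈ univ.filter (fun b : UT N × Fin d => bsrc b = x), c b ^ 2 * w₀ (btgt b)) ≤
    ((∑ b ∈ univ.filter (fun b : UT N × Fin d => btgt b = x), c b ^ 2) +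
      ∑ b ∈ univ.filter (fun b : UT N × Fin d => bsrc b = x), c b ^ 2) * w₀ x)
  {K : ℝ} (hK : 0 ≤ K) (hG : ∀ x' y : UT N, green bsrc btgt c B x' y ≤ K * ((dist x' y + 1) ^ (d - 2))⁻¹)

/-! ## §1 The Green's function is harmonic off its pole -/

include hw₀0 hw₀ in
/-- `x ↦ green B x y` is harmonic at every `x′ ∈ B` with `x′ ≠ y` (`W·green − N green = δ_y` on `B`). [folklore] -/
theorem green_harmonic_off_pole (y x' : UT N) (hx' : x' ∈ B) (hne : x' ≠ y) :
    ((∑ b ∈ univ.filter (fun b : UT N × Fin d => btgt b = x'), c b ^ 2) +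
          ∑ b ∈ univ.filter (fun b : UT N × Fin d => bsrc b = x'), c b ^ 2) * green bsrc btgt c B x' y =
        ((∑ b ∈ univ.filter (fun b : UT N × Fin d => btgt b = x'), c b ^ 2 * green bsrc btgt c B (bsrc b) y) +
          ∑ b ∈ univ.filter (fun b : UT N × Fin d => bsrc b = x'), c b ^ 2 * green bsrc btgt c B (btgt b) y) := by
  have h := dirSol_eq_on bsrc btgt c B w₀ hw₀0 hw₀ (fun w => if w = y then (1 : ℝ) else 0) x' hx'
  simp only [hne, if_false] at h
  simp only [green]
  linarith

include hK hG hw₀0 hw₀ in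
/-- `0 ≤ green ≤ K` everywhere, hence `|green(x₁,y) − green(x₂,y)| ≤ K`. [folklore] -/
theorem abs_green_sub_le (x₁ x₂ y : UT N) : |green bsrc btgt c B x₁ y - green bsrc btgt c B x₂ y| ≤ K := by
  have hle : ∀ x', green bsrc btgt c B x' y ≤ K := by
    intro x'
    refine (hG x' y).trans ?_
    have h1 : (1 : ℝ) ≤ (dist x' y + 1) ^ (d - 2) := one_le_pow₀ (by linarith [dist_nonneg (x := x') (y := y)])
    calc K * ((dist x' y + 1) ^ (d - 2))⁻¹ ≤ K * 1 := mul_le_mul_of_nonneg_left (inv_le_one_of_one_le₀ h1) hK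
      _ = K := mul_one K
  exact abs_sub_le_of_nonneg_le (green_nonneg bsrc btgt c B w₀ hw₀0 hw₀ x₁ y) (hle x₁)
    (green_nonneg bsrc btgt c B w₀ hw₀0 hw₀ x₂ y) (hle x₂)

/-! ## §2 The pointwise dipole bound -/

include hc hc₀ hw₀0 hw₀ hK hG in
/-- **FAR POLES**: `ρ ≥ 1`, `10ρ + 4 ≤ N_i`, `ball(x, 2ρ+2) ⊆ B`, and `dist(x,y) = s ≥ 8` (a natural number) ⟹
`|green(x+e_μ,y) − green(x,y)| ≤ K_d·(K·2^{d−2}·((s+1)^{d−2})⁻¹)·((ρ+1)⁻¹ + 8·(s+1)⁻¹)` — GR1 at radius `R = min(ρ, s/8)`: the ball of radius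
`2R+2 ≤ s/2` around `x` lies in `B`, misses the pole, and sees `green(·,y) ≤ K·((s/2+1)^{d−2})⁻¹` there. [folklore] -/
theorem abs_fdiff_green_le_far [NeZero d] (x : UT N) {ρ : ℕ} (hρ : 1 ≤ ρ) (hN : ∀ i, 10 * ρ + 4 ≤ N i)
    (hball : ∀ x' : UT N, dist x' x ≤ 2 * ρ + 2 → x' ∈ B) (y : UT N) {s : ℕ} (hs : dist x y = s) (hs8 : 8 ≤ s) (μ : Fin d) :
    |green bsrc btgt c B (up x μ) y - green bsrc btgt c B x y| ≤
      Kgrad d * (K * (2 : ℝ) ^ (d - 2) * (((s : ℝ) + 1) ^ (d - 2))⁻¹) * ((((ρ : ℝ) + 1))⁻¹ + 8 * (((s : ℝ) + 1))⁻¹) := by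
  have hd1 : 1 ≤ d := Nat.one_le_iff_ne_zero.mpr (NeZero.ne d)
  set R : ℕ := min ρ (s / 8) with hR
  have hR1 : 1 ≤ R := le_min hρ (by omega)
  have hRρ : R ≤ ρ := min_le_left _ _
  have hRs : R ≤ s / 8 := min_le_right _ _
  have hRN : ∀ i, 10 * R + 4 ≤ N i := fun i => (hN i).trans' (by omega)
  -- `2R + 2 ≤ s/2` in the reals
  have h2R : 2 * (R : ℝ) + 2 ≤ (s : ℝ) / 2 := by
    have h1 : 8 * (s / 8) ≤ s := Nat.mul_div_le s 8
    have h3 : (4 * (2 * R + 2) : ℕ) ≤ 2 * s := by omega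
    have h4 : ((4 * (2 * R + 2) : ℕ) : ℝ) ≤ ((2 * s : ℕ) : ℝ) := by exact_mod_cast h3
    push_cast at h4
    linarith
  set M : ℝ := K * (2 : ℝ) ^ (d - 2) * (((s : ℝ) + 1) ^ (d - 2))⁻¹ with hM
  -- harmonicity on the ball of radius `2R+2` around `x`
  have hu : ∀ x' ∈ univ.filter (fun x' : UT N => dist x' x ≤ 2 * R + 2),
      ((∑ b ∈ univ.filter (fun b : UT N × Fin d => btgt b = x'), c b ^ 2) +
          ∑ b ∈ univ.filter (fun b : UT N × Fin d => bsrc b = x'), c b ^ 2) * green bsrc btgt c B x' y =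
        ((∑ b ∈ univ.filter (fun b : UT N × Fin d => btgt b = x'), c b ^ 2 * green bsrc btgt c B (bsrc b) y) +
          ∑ b ∈ univ.filter (fun b : UT N × Fin d => bsrc b = x'), c b ^ 2 * green bsrc btgt c B (btgt b) y) := by
    intro x' hx'
    have hd' := (Finset.mem_filter.mp hx').2
    refine green_harmonic_off_pole B w₀ hw₀0 hw₀ y x' (hball x' (by linarith [show (R : ℝ) ≤ ρ from by exact_mod_cast hRρ])) ?_
    intro heq
    rw [heq] at hd'
    have : dist y x = s := by rw [dist_comm, hs]
    rw [this] at hd'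
    have h8 : (8 : ℝ) ≤ s := by exact_mod_cast hs8
    linarith
  -- the bound on that ball: the pole is at distance `≥ s/2`
  have hMb : ∀ x' ∈ univ.filter (fun x' : UT N => dist x' x ≤ 2 * R + 2), |green bsrc btgt c B x' y| ≤ M := by
    intro x' hx'
    have hd' := (Finset.mem_filter.mp hx').2
    rw [abs_of_nonneg (green_nonneg bsrc btgt c B w₀ hw₀0 hw₀ x' y)]
    refine (hG x' y).trans ?_
    -- `dist x' y + 1 ≥ (s+1)/2`
    have hfar : ((s : ℝ) + 1) / 2 ≤ dist x' y + 1 := by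
      have ht : dist x y ≤ dist x x' + dist x' y := dist_triangle x x' y
      rw [hs, dist_comm x x'] at ht
      linarith
    have hpos : 0 < ((s : ℝ) + 1) / 2 := by positivity
    have hpow : (((s : ℝ) + 1) / 2) ^ (d - 2) ≤ (dist x' y + 1) ^ (d - 2) := pow_le_pow_left₀ hpos.le hfar _
    rw [hM]
    calc K * ((dist x' y + 1) ^ (d - 2))⁻¹ ≤ K * ((((s : ℝ) + 1) / 2) ^ (d - 2))⁻¹ :=
          mul_le_mul_of_nonneg_left (inv_anti₀ (pow_pos hpos _) hpow) hK
      _ = K * (2 : ℝ) ^ (d - 2) * (((s : ℝ) + 1) ^ (d - 2))⁻¹ := by rw [div_pow, inv_div, div_eq_mul_inv]; ring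
  have hfd := harmonic_fdiff_le hc hc₀ x hR1 hRN (fun x' => green bsrc btgt c B x' y) hu hMb μ
  -- `1/(R+1) ≤ 1/(ρ+1) + 8/(s+1)`
  have hM0 : 0 ≤ M := by rw [hM]; positivity
  have hKM : 0 ≤ Kgrad d * M := mul_nonneg (Kgrad_nonneg hd1) hM0
  have hinv : ((R : ℝ) + 1)⁻¹ ≤ (((ρ : ℝ) + 1))⁻¹ + 8 * (((s : ℝ) + 1))⁻¹ := by
    have hρ0 : (0 : ℝ) < (ρ : ℝ) + 1 := by positivity
    have hs0 : (0 : ℝ) < (s : ℝ) + 1 := by positivity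
    rcases min_choice ρ (s / 8) with hm | hm
    · rw [hR, hm]
      have : 0 ≤ 8 * (((s : ℝ) + 1))⁻¹ := by positivity
      linarith
    · rw [hR, hm]
      have h1 : ((s : ℝ) + 1) / 8 ≤ ((s / 8 : ℕ) : ℝ) + 1 := by
        have h2 : s + 1 ≤ 8 * (s / 8) + 8 := by omega
        have h3 : ((s + 1 : ℕ) : ℝ) ≤ ((8 * (s / 8) + 8 : ℕ) : ℝ) := by exact_mod_cast h2
        push_cast at h3
        linarith
      have hq : 0 < ((s : ℝ) + 1) / 8 := by positivity
      calc (((s / 8 : ℕ) : ℝ) + 1)⁻¹ ≤ (((s : ℝ) + 1) / 8)⁻¹ := inv_anti₀ hq h1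
        _ = 8 * (((s : ℝ) + 1))⁻¹ := by rw [inv_div, div_eq_mul_inv]
        _ ≤ (((ρ : ℝ) + 1))⁻¹ + 8 * (((s : ℝ) + 1))⁻¹ := by
            have h0 : 0 ≤ (((ρ : ℝ) + 1))⁻¹ := by positivity
            linarith
  calc |green bsrc btgt c B (up x μ) y - green bsrc btgt c B x y| ≤ Kgrad d * M / ((R : ℝ) + 1) := hfd
    _ = Kgrad d * M * ((R : ℝ) + 1)⁻¹ := div_eq_mul_inv _ _
    _ ≤ Kgrad d * M * ((((ρ : ℝ) + 1))⁻¹ + 8 * (((s : ℝ) + 1))⁻¹) := mul_le_mul_of_nonneg_left hinv hKM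

/-- **The dipole constant** `C₁ = 8·2^{d−2}·K_d + 8^{d−1}` — depends on `d` only. [folklore] -/
def Cdip (d : ℕ) : ℝ := 8 * (2 : ℝ) ^ (d - 2) * Kgrad d + (8 : ℝ) ^ (d - 1)

omit [∀ i, NeZero (N i)] in
/-- `C₁ ≥ 0` (`d ≥ 1`). [folklore] -/
theorem Cdip_nonneg {d : ℕ} (hd : 1 ≤ d) : 0 ≤ Cdip d := by
  unfold Cdip; have := Kgrad_nonneg hd; positivity

include hc hc₀ hw₀0 hw₀ hK hG in
/-- **THE POINTWISE DIPOLE BOUND, ALL POLES**: under §2's interiority hypotheses, for every `y` with `dist(x,y) = s`,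
`|green(x+e_μ,y) − green(x,y)| ≤ C₁·K·(((s+1)^{d−1})⁻¹ + ((s+1)^{d−2})⁻¹·(ρ+1)⁻¹)` (far poles by `abs_fdiff_green_le_far`, near poles
`s ≤ 7` by `0 ≤ green ≤ K` and `(s+1)^{d−1} ≤ 8^{d−1}`). [folklore] -/
theorem abs_fdiff_green_le [NeZero d] (x : UT N) {ρ : ℕ} (hρ : 1 ≤ ρ) (hN : ∀ i, 10 * ρ + 4 ≤ N i)
    (hball : ∀ x' : UT N, dist x' x ≤ 2 * ρ + 2 → x' ∈ B) (y : UT N) {s : ℕ} (hs : dist x y = s) (μ : Fin d) :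
    |green bsrc btgt c B (up x μ) y - green bsrc btgt c B x y| ≤
      Cdip d * K * ((((s : ℝ) + 1) ^ (d - 1))⁻¹ + (((s : ℝ) + 1) ^ (d - 2))⁻¹ * (((ρ : ℝ) + 1))⁻¹) := by
  have hd1 : 1 ≤ d := Nat.one_le_iff_ne_zero.mpr (NeZero.ne d)
  have hKg := Kgrad_nonneg hd1
  have hs0 : (0 : ℝ) < (s : ℝ) + 1 := by positivity
  have hρ0 : (0 : ℝ) < (ρ : ℝ) + 1 := by positivity
  set A : ℝ := (((s : ℝ) + 1) ^ (d - 1))⁻¹ with hA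
  set A' : ℝ := (((s : ℝ) + 1) ^ (d - 2))⁻¹ * (((ρ : ℝ) + 1))⁻¹ with hA'
  have hA0 : 0 ≤ A := by positivity
  have hA'0 : 0 ≤ A' := by positivity
  by_cases h8 : 8 ≤ s
  · have hfar := abs_fdiff_green_le_far hc hc₀ B w₀ hw₀0 hw₀ hK hG x hρ hN hball y hs h8 μ
    -- `(s+1)^{-(d-2)}·8(s+1)^{-1} = 8·(s+1)^{-(d-1)}`
    have hpow : (((s : ℝ) + 1) ^ (d - 2))⁻¹ * (8 * (((s : ℝ) + 1))⁻¹) ≤ 8 * A := by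
      rcases Nat.lt_or_ge d 2 with hd2 | hd2
      · have hd : d = 1 := by omega
        subst hd
        simp only [hA]
        norm_num
        have : (((s : ℝ) + 1))⁻¹ ≤ 1 := inv_le_one_of_one_le₀ (by linarith)
        linarith
      · have e : ((s : ℝ) + 1) ^ (d - 1) = ((s : ℝ) + 1) ^ (d - 2) * ((s : ℝ) + 1) := by
          rw [← pow_succ]; congr 1; omega
        rw [hA, e, mul_inv]
        apply le_of_eq; ring
    calc |green bsrc btgt c B (up x μ) y - green bsrc btgt c B x y|
        ≤ Kgrad d * (K * (2 : ℝ) ^ (d - 2) * (((s : ℝ) + 1) ^ (d - 2))⁻¹) * ((((ρ : ℝ) + 1))⁻¹ + 8 * (((s : ℝ) + 1))⁻¹) := hfar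
      _ = (2 : ℝ) ^ (d - 2) * Kgrad d * K * (A' + (((s : ℝ) + 1) ^ (d - 2))⁻¹ * (8 * (((s : ℝ) + 1))⁻¹)) := by
          rw [hA']; ring
      _ ≤ (2 : ℝ) ^ (d - 2) * Kgrad d * K * (A' + 8 * A) := by gcongr
      _ ≤ Cdip d * K * (A + A') := by
          rw [Cdip]
          nlinarith [mul_nonneg (mul_nonneg (pow_nonneg (by norm_num : (0:ℝ) ≤ 2) (d - 2)) hKg) hK,
            mul_nonneg (pow_nonneg (by norm_num : (0:ℝ) ≤ 8) (d - 1)) hK, mul_nonneg hA0 hK, mul_nonneg hA'0 hK]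
  · -- near poles: `|·| ≤ K ≤ 8^{d−1}·K·A`
    push Not at h8
    have hnear := abs_green_sub_le B w₀ hw₀0 hw₀ hK hG (up x μ) x y
    have hsA : (1 : ℝ) ≤ (8 : ℝ) ^ (d - 1) * A := by
      rw [hA]
      have hle : ((s : ℝ) + 1) ^ (d - 1) ≤ (8 : ℝ) ^ (d - 1) := by
        refine pow_le_pow_left₀ hs0.le ?_ _
        have : ((s : ℕ) : ℝ) + 1 ≤ 8 := by
          have h' : s + 1 ≤ 8 := by omega
          exact_mod_cast h'
        exact this
      have hp : 0 < ((s : ℝ) + 1) ^ (d - 1) := pow_pos hs0 _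
      rw [← div_eq_mul_inv, le_div_iff₀ hp, one_mul]
      exact hle
    calc |green bsrc btgt c B (up x μ) y - green bsrc btgt c B x y| ≤ K := hnear
      _ ≤ K * ((8 : ℝ) ^ (d - 1) * A) := le_mul_of_one_le_right hK hsA
      _ ≤ Cdip d * K * (A + A') := by
          rw [Cdip]
          nlinarith [mul_nonneg (mul_nonneg (pow_nonneg (by norm_num : (0:ℝ) ≤ 2) (d - 2)) hKg) hK,
            mul_nonneg (pow_nonneg (by norm_num : (0:ℝ) ≤ 8) (d - 1)) hK, mul_nonneg hA0 hK, mul_nonneg hA'0 hK]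

/-! ## §3 THE DIPOLE ROW SUM -/

omit [∀ i, NeZero (N i)] in
/-- `((s+1)^{d−2})⁻¹ ≤ (D+1)·((s+1)^{d−1})⁻¹` for `s ≤ D` (all `d`). [folklore] -/
theorem inv_pow_pred_le (d : ℕ) {s D : ℕ} (hsD : s ≤ D) :
    (((s : ℝ) + 1) ^ (d - 2))⁻¹ ≤ ((D : ℝ) + 1) * (((s : ℝ) + 1) ^ (d - 1))⁻¹ := by
  have hs0 : (0 : ℝ) < (s : ℝ) + 1 := by positivity
  have hsR : (s : ℝ) ≤ D := by exact_mod_cast hsD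
  have hsD' : (s : ℝ) + 1 ≤ (D : ℝ) + 1 := by linarith
  rcases Nat.lt_or_ge d 2 with hd2 | hd2
  · have e1 : d - 2 = 0 := by omega
    have e2 : d - 1 = 0 ∨ d - 1 = 0 := by omega
    rw [e1, e2.elim id id]
    simp only [pow_zero, inv_one, mul_one]
    linarith
  · have e : ((s : ℝ) + 1) ^ (d - 1) = ((s : ℝ) + 1) ^ (d - 2) * ((s : ℝ) + 1) := by
      rw [← pow_succ]; congr 1; omega
    rw [e, mul_inv]
    have hp : 0 < (((s : ℝ) + 1) ^ (d - 2))⁻¹ := by positivity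
    calc (((s : ℝ) + 1) ^ (d - 2))⁻¹ = (((s : ℝ) + 1) ^ (d - 2))⁻¹ * (((s : ℝ) + 1) * ((s : ℝ) + 1)⁻¹) := by
          rw [mul_inv_cancel₀ hs0.ne', mul_one]
      _ ≤ (((s : ℝ) + 1) ^ (d - 2))⁻¹ * (((D : ℝ) + 1) * ((s : ℝ) + 1)⁻¹) := by gcongr
      _ = ((D : ℝ) + 1) * ((((s : ℝ) + 1) ^ (d - 2))⁻¹ * ((s : ℝ) + 1)⁻¹) := by ring

include hc hc₀ hw₀0 hw₀ hK hG in
/-- **THE DIPOLE ROW SUM OF THE DIRICHLET GREEN'S FUNCTION (free torus Laplacian, constant weight, flat transport).**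
`B` carries a unit supersolution and the pointwise Green bound `green B x′ y ≤ K·((dist x′ y + 1)^{d−2})⁻¹`; `x` is `ρ`-interior
(`ball(x, 2ρ+2) ⊆ B`, `ρ ≥ 1`, `10ρ + 4 ≤ N_i`) and `dist(x,y) ≤ D` on `B`.  Then for every axis `μ`:
`Σ_{y ∈ B} |green B (x+e_μ) y − green B x y| ≤ C₁·C_ps·K·(D+1)·(1 + (D+1)/(ρ+1))` — the (3.42)₂ mechanism: one power of the radius.
[cite: Balaban1985BackgroundPropagators, Thm 3.1 (3.42) p.397] [folklore] -/
theorem sum_abs_fdiff_green_le [NeZero d] (x : UT N) {ρ : ℕ} (hρ : 1 ≤ ρ) (hN : ∀ i, 10 * ρ + 4 ≤ N i)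
    (hball : ∀ x' : UT N, dist x' x ≤ 2 * ρ + 2 → x' ∈ B) {D : ℕ} (hBD : ∀ y ∈ B, dist x y ≤ D) (μ : Fin d) :
    ∑ y ∈ B, |green bsrc btgt c B (up x μ) y - green bsrc btgt c B x y| ≤
      Cdip d * Cps d * K * ((D : ℝ) + 1) * (1 + ((D : ℝ) + 1) / ((ρ : ℝ) + 1)) := by
  have hd1 : 1 ≤ d := Nat.one_le_iff_ne_zero.mpr (NeZero.ne d)
  have hC1 := Cdip_nonneg hd1
  have hρ0 : (0 : ℝ) < (ρ : ℝ) + 1 := by positivity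
  -- pointwise, with the torus distance read as a natural number
  have hpt : ∀ y ∈ B, |green bsrc btgt c B (up x μ) y - green bsrc btgt c B x y| ≤
      Cdip d * K * (((dist x y + 1) ^ (d - 1))⁻¹ + ((D : ℝ) + 1) * (((ρ : ℝ) + 1))⁻¹ * ((dist x y + 1) ^ (d - 1))⁻¹) := by
    intro y hy
    obtain ⟨s, hs⟩ := dist_natCast x y
    have hsD : s ≤ D := by have h := hBD y hy; rw [hs] at h; exact_mod_cast h
    have h1 := abs_fdiff_green_le hc hc₀ B w₀ hw₀0 hw₀ hK hG x hρ hN hball y hs μ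
    have h2 := inv_pow_pred_le d hsD
    rw [hs]
    refine h1.trans (mul_le_mul_of_nonneg_left ?_ (mul_nonneg hC1 hK))
    have h3 : (((s : ℝ) + 1) ^ (d - 2))⁻¹ * (((ρ : ℝ) + 1))⁻¹ ≤ ((D : ℝ) + 1) * (((ρ : ℝ) + 1))⁻¹ * (((s : ℝ) + 1) ^ (d - 1))⁻¹ := by
      calc (((s : ℝ) + 1) ^ (d - 2))⁻¹ * (((ρ : ℝ) + 1))⁻¹ ≤ (((D : ℝ) + 1) * (((s : ℝ) + 1) ^ (d - 1))⁻¹) * (((ρ : ℝ) + 1))⁻¹ :=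
            mul_le_mul_of_nonneg_right h2 (by positivity)
        _ = _ := by ring
    linarith
  have hsum := sum_inv_pow_dist_le x B hBD
  have hCps := Cps_nonneg d
  calc ∑ y ∈ B, |green bsrc btgt c B (up x μ) y - green bsrc btgt c B x y|
      ≤ ∑ y ∈ B, Cdip d * K * (((dist x y + 1) ^ (d - 1))⁻¹ + ((D : ℝ) + 1) * (((ρ : ℝ) + 1))⁻¹ * ((dist x y + 1) ^ (d - 1))⁻¹) :=
        Finset.sum_le_sum hpt
    _ = Cdip d * K * (1 + ((D : ℝ) + 1) * (((ρ : ℝ) + 1))⁻¹) * ∑ y ∈ B, ((dist x y + 1) ^ (d - 1))⁻¹ := by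
        rw [Finset.mul_sum]
        exact Finset.sum_congr rfl fun y _ => by ring
    _ ≤ Cdip d * K * (1 + ((D : ℝ) + 1) * (((ρ : ℝ) + 1))⁻¹) * (Cps d * ((D : ℝ) + 1)) :=
        mul_le_mul_of_nonneg_left hsum (by positivity)
    _ = Cdip d * Cps d * K * ((D : ℝ) + 1) * (1 + ((D : ℝ) + 1) / ((ρ : ℝ) + 1)) := by rw [div_eq_mul_inv]; ring

end Green

end

end Summit.QuantumFields.BalabanUV.Beta.GreenGradientRowSum
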